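import Mathlib
import Summits.ABC.ABC.Statement
import Summits.ABC.ABC.Theorems.SoloInformedPLRung

/-!
# abc ⟹ PL in Philippon's printed parameter ranges (solo-ABC-informed, session 17, addendum)

`SoloInformedPLRung.lean` proves `ABC ⟹ PL` in the parameter ranges in which the tree TYPES Philippon's
conjecture (`0 ≤ ε < 1/2`, `α ≥ 0`, `β ≥ 0`, `B ≥ 1`; hypothesis `hPL` of
`soloInformed_polynomialABC_of_philippon`), with the witness `ε = α = 9/20`, `B = 5`.  Philippon PRINTS the
conjecture with `0 < ε < 1/2`, `α ≥ 1`, `β ≥ 0` [cite: Philippon2000Addendum, Conjecture, p. 167,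
"Il existe des réels 0 < ε < 1/2, α ≥ 1, β ≥ 0 et un entier B ∈ ℕ*"].  Since the right-hand side of PL,
`B (α h(x) + ε h(y)) + (α B + ε)(log rad num (x y^B + 1) + β)`, is non-decreasing in `α` and in `ε`
(`h ≥ 0`, `log rad ≥ 0`, `β ≥ 0`), the implication holds verbatim in the printed ranges as well
(`soloInformed_philippon_of_abc_printed`: `B = 5`, `ε = 9/20`, `α = 1`).  This file is that one-step
monotonicity, kernel-checked so that the seat's report need not carry it as prose.  Mathlib + `Statement` +
`SoloInformedPLRung` only; no new `Prop` constants. [cite: Philippon2000Addendum, Conjecture p. 167 and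
Remarque (3) p. 169]
-/

noncomputable section

open Real Height UniqueFactorizationMonoid
open Literature.NumberTheory.DiophantineGeometry

namespace Summit.ABC.ABC.Theorems

/-- Monotonicity of PL's right-hand side in the parameters `α` and `ε`. [folklore] -/
theorem soloInformed_philipponRHS_mono {B : ℕ} {α α' ε ε' β u v r : ℝ}
    (hα : α ≤ α') (hε : ε ≤ ε') (hβ : 0 ≤ β) (hu : 0 ≤ u) (hv : 0 ≤ v) (hr : 0 ≤ r) :
    (B : ℝ) * (α * u + ε * v) + (α * B + ε) * (r + β) ≤
      (B : ℝ) * (α' * u + ε' * v) + (α' * B + ε') * (r + β) := by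
  have hB : (0 : ℝ) ≤ B := by positivity
  have h1 : (B : ℝ) * (α * u + ε * v) ≤ (B : ℝ) * (α' * u + ε' * v) := by
    refine mul_le_mul_of_nonneg_left ?_ hB
    nlinarith [mul_le_mul_of_nonneg_right hα hu, mul_le_mul_of_nonneg_right hε hv]
  have h2 : (α * B + ε) * (r + β) ≤ (α' * B + ε') * (r + β) := by
    refine mul_le_mul_of_nonneg_right ?_ (by linarith)
    nlinarith [mul_le_mul_of_nonneg_right hα hB]
  linarith

/-- **abc ⟹ PL in Philippon's printed ranges.** If the abc conjecture holds then there are reals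
`0 < ε < 1/2`, `α ≥ 1`, `β ≥ 0` and an integer `B ≥ 1` (namely `B = 5`, `ε = 9/20`, `α = 1`) such that
for all `x, y ∈ ℚ^×` with `x y^B ≠ −1`,
`log |num (x y^B + 1)| ≤ B (α h(x) + ε h(y)) + (α B + ε)(log rad num (x y^B + 1) + β)`.
Obtained from `soloInformed_philippon_of_abc_of_le` (`B = 5`, some `0 ≤ ε₀ < 1/2`, `α₀ ≥ 0`) by raising
`α₀ ↦ max α₀ 1` and `ε₀ ↦ max ε₀ (9/20)` with `soloInformed_philipponRHS_mono`.
[cite: Philippon2000Addendum, Conjecture p. 167; Remarque (3) p. 169] -/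
theorem soloInformed_philippon_of_abc_printed (hABC : ABC) :
    ∃ (ε α β : ℝ) (B : ℕ), 0 < ε ∧ ε < 1 / 2 ∧ 1 ≤ α ∧ 0 ≤ β ∧ 0 < B ∧
      ∀ x y : ℚ, x ≠ 0 → y ≠ 0 → x * y ^ B + 1 ≠ 0 →
        Real.log (((x * y ^ B + 1).num.natAbs : ℕ) : ℝ) ≤
          (B : ℝ) * (α * logHeight₁ x + ε * logHeight₁ y) +
            (α * B + ε) * (Real.log ((radical (x * y ^ B + 1).num.natAbs : ℕ) : ℝ) + β) := by
  obtain ⟨ε₀, α₀, β, hε0, hε2, hα0, hβ0, hB, h⟩ :=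
    soloInformed_philippon_of_abc_of_le hABC (le_refl 5)
  refine ⟨max ε₀ (9 / 20), max α₀ 1, β, 5, ?_, ?_, le_max_right _ _, hβ0, hB, fun x y hx hy hne => ?_⟩
  · exact lt_of_lt_of_le (by norm_num) (le_max_right _ _)
  · exact max_lt hε2 (by norm_num)
  · have hmain := h x y hx hy hne
    have hx0 : 0 ≤ logHeight₁ x := zero_le_logHeight₁ x
    have hy0 : 0 ≤ logHeight₁ y := zero_le_logHeight₁ y
    have hr0 : 0 ≤ Real.log ((radical (x * y ^ 5 + 1).num.natAbs : ℕ) : ℝ) :=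
      Real.log_nonneg (by exact_mod_cast Nat.radical_pos _)
    exact hmain.trans
      (soloInformed_philipponRHS_mono (le_max_left α₀ 1) (le_max_left ε₀ (9 / 20)) hβ0 hx0 hy0 hr0)

/-- **The PL rung in the printed ranges:** `(ABC → PL_printed) ∧ (PL_printed → (W))`, where `PL_printed`
is Philippon's conjecture with his parameter ranges `0 < ε < 1/2`, `α ≥ 1`, `β ≥ 0`, `B ≥ 1`, and (W) is
polynomial abc `∃ M K, 0 < K ∧ ∀ abc-triples, c ≤ K · rad(abc)^M`.  The second conjunct specialises
`soloInformed_polynomialABC_of_philippon` (which needs only `0 ≤ ε`, `0 ≤ α`).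
[cite: Philippon2000Addendum, Conjecture and Conséquence p. 167, Remarque (3) p. 169] -/
theorem soloInformed_PL_rung_printed :
    (ABC →
      ∃ (ε α β : ℝ) (B : ℕ), 0 < ε ∧ ε < 1 / 2 ∧ 1 ≤ α ∧ 0 ≤ β ∧ 0 < B ∧
        ∀ x y : ℚ, x ≠ 0 → y ≠ 0 → x * y ^ B + 1 ≠ 0 →
          Real.log (((x * y ^ B + 1).num.natAbs : ℕ) : ℝ) ≤
            (B : ℝ) * (α * logHeight₁ x + ε * logHeight₁ y) +
              (α * B + ε) * (Real.log ((radical (x * y ^ B + 1).num.natAbs : ℕ) : ℝ) + β)) ∧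
    ((∃ (ε α β : ℝ) (B : ℕ), 0 < ε ∧ ε < 1 / 2 ∧ 1 ≤ α ∧ 0 ≤ β ∧ 0 < B ∧
        ∀ x y : ℚ, x ≠ 0 → y ≠ 0 → x * y ^ B + 1 ≠ 0 →
          Real.log (((x * y ^ B + 1).num.natAbs : ℕ) : ℝ) ≤
            (B : ℝ) * (α * logHeight₁ x + ε * logHeight₁ y) +
              (α * B + ε) * (Real.log ((radical (x * y ^ B + 1).num.natAbs : ℕ) : ℝ) + β)) →
      ∃ M : ℕ, ∃ K : ℝ, 0 < K ∧
        ∀ a b c : ℕ, IsABCTriple a b c → (c : ℝ) ≤ K * ((rad a b c : ℕ) : ℝ) ^ M) := by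
  refine ⟨soloInformed_philippon_of_abc_printed, ?_⟩
  rintro ⟨ε, α, β, B, hε0, hε2, hα1, hβ0, hB, h⟩
  exact soloInformed_polynomialABC_of_philippon hε0.le hε2 (by linarith) hβ0 hB h

end Summit.ABC.ABC.Theorems

end
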